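import Summits.ABC.IUTFork.Cor312GapWitnessProvenance
import Summits.ABC.IUTFork.Cor312ReadingIso
import Summits.ABC.IUTFork.Cor312LogKummerRoute
import HarnessLib

/-!
# TEAM A gap witness, part D: every catalogued SUFFICIENT READING of Step (xi) fails at a provenance-respecting
# setting (support piece A-4′, abc-iut-w4-d026; proof-only)

Record-only file (D-0012) of the abc-iut cell (Cor. 3.12 cone, D-0067; `HOME/plan/ADJUDICATION-SPEC.md` §2 (G3)
"STRONG = a kernel countermodel `∃ P, F.Statement ∧ BridgeHyps P ∧ … ∧ ¬ GapA P`"); TAKES NO SIDE; proof-only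
companion of `Cor312GapWitnessProvenance` (part C: over EVERY index skeleton and for every `c > 0` the setting
`GapWitnessProv.setting v_ℚ⁰ c` satisfies typed Thm. 3.11 in full, every bridge hypothesis, `|log(q)| > 0`,
`−|log(q)| = −c`, and `¬ Statement`; with `Cor312Prov.IsSettingOf D ·` over `thetaIndexOfInitial D`). By contraposition
of the landed `statement_of_*` theorems, EVERY sufficient reading of the disputed Step (xi) catalogued by the cell
FAILS at that setting — READING 0 (`statement_of_qLocal_le`, pointwise volumes), READING 1
(`statement_of_represented`), READING 2 (`statement_of_qRegion_subset_thetaHull`), READING 3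
(`statement_of_qRegion_mem_possibleImages`), READING 4 (Yamashita, `IsoContainment`) — so each of them is
(G3)-STRONG-independent of {typed Thm. 3.11, bridge hypotheses, provenance `IsSettingOf`}:
`readings_fail_at_provenance_witness` — together with Team B's B-INPUT `Cor312Vol.VolumeTransport`
(`statement_of_volumeTransport`; the Θ-regions are admissible at the witness, `ThetaRegionsAdm`). Interface/provenance
level only; says nothing about which reading print intends, nor about (xi-f). [claim: Mochizuki2012, status: disputed]
-/

noncomputable section

namespace Summit.ABC

namespace IUTFork

namespace Cor312Vol

namespace GapWitnessProv

open Thm311 Cor312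

variable {T : ThetaIndex} (vQ₀ : T.VQ) (c : ℝ)

/-- READING 0 (pointwise `qLocal ≤ thetaLocal`, the weakest volume interface of `Cor312ReadingIso`) FAILS at the
witness (`c > 0`): it would give `Statement` (`statement_of_qLocal_le`). [folklore] -/
theorem not_reading0 (hc : 0 < c) :
    ¬ ∀ (i : Fin T.lstar) (vQ : T.VQ), (setting vQ₀ c).qLocal (Setting.labelSucc i) vQ ≤
        ((setting vQ₀ c).thetaLocal (Setting.labelSucc i) vQ).untopD 0 :=
  fun h => not_statement vQ₀ c hc (statement_of_qLocal_le (bridgeHyps vQ₀ c hc.le) h)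

/-- READING 1 (`RepresentedVol`: some global choice of possible images has assembled log-volume `−|log(q)|`)
FAILS at the witness (`statement_of_represented`). [folklore] -/
theorem not_reading1 (hc : 0 < c) :
    ¬ ∃ U : ImageChoice (setting vQ₀ c),
        (toLocalFamily (setting vQ₀ c) (bridgeHyps vQ₀ c hc.le).mono).assemble.logvol (Set.univ.pi U.1) =
          (setting vQ₀ c).negLogQ :=
  fun h => not_statement vQ₀ c hc (statement_of_represented (bridgeHyps vQ₀ c hc.le) h)

/-- READING 2 (`qRegion ⊆ thetaHull` in every packet) FAILS at the witness
(`statement_of_qRegion_subset_thetaHull`). [folklore] -/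
theorem not_reading2 (hc : 0 < c) :
    ¬ ∀ (i : Fin T.lstar) (vQ : T.VQ),
        (setting vQ₀ c).qRegion (Setting.labelSucc i) vQ ⊆ (setting vQ₀ c).thetaHull _ vQ :=
  fun h => not_statement vQ₀ c hc (statement_of_qRegion_subset_thetaHull (bridgeHyps vQ₀ c hc.le) h)

/-- READING 3 (`qRegion ∈ possibleImages` in every packet) FAILS at the witness
(`statement_of_qRegion_mem_possibleImages`). [folklore] -/
theorem not_reading3 (hc : 0 < c) :
    ¬ ∀ (i : Fin T.lstar) (vQ : T.VQ),
        (setting vQ₀ c).qRegion (Setting.labelSucc i) vQ ∈ (setting vQ₀ c).possibleImages _ vQ :=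
  fun h => not_statement vQ₀ c hc (statement_of_qRegion_mem_possibleImages (bridgeHyps vQ₀ c hc.le) h)

/-- READING 4 (Yamashita's «isomorphic subregion», `IsoContainment`) FAILS at the witness
(`statement_of_isoContainment`). [folklore] -/
theorem not_reading4 (hc : 0 < c) : ¬ IsoContainment (setting vQ₀ c) :=
  fun h => not_statement vQ₀ c hc (statement_of_isoContainment (bridgeHyps vQ₀ c hc.le) h)

/-- The Θ-pilot regions of the witness are admissible (everything is). [folklore] -/
theorem thetaRegionsAdm : ThetaRegionsAdm (setting vQ₀ c) := fun _ _ _ => trivial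

/-- Team B's B-INPUT `VolumeTransport` (per packet, `qLocal ≤ logvol` of SOME Kummer image of the Θ-pilot) FAILS at
the witness (`statement_of_volumeTransport`, the Θ-regions being admissible). [folklore] -/
theorem not_volumeTransport (hc : 0 < c) : ¬ VolumeTransport (setting vQ₀ c) :=
  fun h => not_statement vQ₀ c hc
    (statement_of_volumeTransport _ (bridgeHyps vQ₀ c hc.le) (thetaRegionsAdm vQ₀ c) h)

end GapWitnessProv

open Thm311 Cor312 Literature.IUT.HodgeTheaters NumberField in
/-- **Every catalogued sufficient reading of Step (xi) fails at a provenance-respecting setting — (G3)-STRONG for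
each candidate gap statement.** For EVERY collection of initial Θ-data `D` with `log(q) > 0` there are a full
situation over `thetaIndexOfInitial D` and a setting `P` with `Cor312Prov.IsSettingOf D P`, typed Thm. 3.11
(i)∧(ii)∧(iii), every bridge hypothesis, `|log(q)| > 0`, admissible Θ-regions, at which READING 0, READING 2,
READING 3, READING 4 and Team B's `VolumeTransport` are all FALSE (READING 1, whose statement mentions the bridge
hypotheses, fails at the same setting: `GapWitnessProv.not_reading1`). [claim: Mochizuki2012, status: disputed] -/
theorem readings_fail_at_provenance_witness {F K Fbar : Type} [Field F] [NumberField F]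
    [Field K] [NumberField K] [Algebra F K] [Field Fbar] [Algebra F Fbar] [Algebra K Fbar]
    {E : WeierstrassCurve F} [E.IsElliptic] {l : ℕ} {Pb : BadPlacePredicates K}
    (D : InitialThetaData F K Fbar E l Pb) (hq : 0 < Cor312Prov.logq D) :
    ∃ (F₁ : FullSituation (Thm311.Real.thetaIndexOfInitial D))
      (P : Setting F₁.toLatticeSituation.toSituation),
      Cor312Prov.IsSettingOf D P ∧ F₁.Statement ∧ BridgeHyps P ∧ P.AbsLogQPos ∧ ThetaRegionsAdm P ∧
      (¬ ∀ (i : Fin (Thm311.Real.thetaIndexOfInitial D).lstar) (vQ : (Thm311.Real.thetaIndexOfInitial D).VQ),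
          P.qLocal (Setting.labelSucc i) vQ ≤ (P.thetaLocal (Setting.labelSucc i) vQ).untopD 0) ∧
      (¬ ∀ (i : Fin (Thm311.Real.thetaIndexOfInitial D).lstar) (vQ : (Thm311.Real.thetaIndexOfInitial D).VQ),
          P.qRegion (Setting.labelSucc i) vQ ⊆ P.thetaHull _ vQ) ∧
      (¬ ∀ (i : Fin (Thm311.Real.thetaIndexOfInitial D).lstar) (vQ : (Thm311.Real.thetaIndexOfInitial D).VQ),
          P.qRegion (Setting.labelSucc i) vQ ∈ P.possibleImages _ vQ) ∧
      ¬ IsoContainment P ∧ ¬ VolumeTransport P := by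
  have hl : 0 < (l : ℝ) := by exact_mod_cast lt_of_lt_of_le (by norm_num) D.five_le_l
  have hc : 0 < Cor312Prov.absLogq D := by unfold Cor312Prov.absLogq; positivity
  obtain ⟨v, -⟩ := (Thm311.Real.thetaIndexOfInitial D).Vbad_nonempty
  refine ⟨GapWitnessProv.full ((Thm311.Real.thetaIndexOfInitial D).over v) (Cor312Prov.absLogq D),
    GapWitnessProv.setting ((Thm311.Real.thetaIndexOfInitial D).over v) (Cor312Prov.absLogq D),
    Cor312Prov.isSettingOf_ofInitial D _ (GapWitnessProv.negLogQ_eq _ _),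
    GapWitnessProv.full_statement _ _, GapWitnessProv.bridgeHyps _ _ hc.le, GapWitnessProv.absLogQPos _ _ hc,
    GapWitnessProv.thetaRegionsAdm _ _, GapWitnessProv.not_reading0 _ _ hc, GapWitnessProv.not_reading2 _ _ hc,
    GapWitnessProv.not_reading3 _ _ hc, GapWitnessProv.not_reading4 _ _ hc, GapWitnessProv.not_volumeTransport _ _ hc⟩

end Cor312Vol

end IUTFork

end Summit.ABC

end
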